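import Summits.CriticalPhenomena.PercolationContinuityZ3.Theorems.PercNearOneGluingNoHeavyPcintKernNFZ5B7Defs
import Summits.CriticalPhenomena.PercolationContinuityZ3.Theorems.PercNearOneGluingNoHeavyPcintWinKernelTree
import HarnessLib

/-!
# PCINT lane, kernel check 2/4 of the B3r window certificate `d = 5`, memory 7 (6-step windows; 1538 first-use normal forms of 1000000 codes): normal-form codes in `[276420, 402000)`

Cell `prim-pcint`, seat `prim-pcint-2` (gen 2).  Collatz–Wielandt rows `10^5 · row ≤ 99999 · DEN · v` on the 257 normal-form codes in
`[276420, 402000)` (`WinK.nfCodesIn`), by `decide +kernel` in blocks of at most `48` rows (`WinK.allB`, natural-number arithmetic only;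
`maxHeartbeats 0`) — table values read from the search tree `WinK.KT.ofListF 11 tbl` (`…PcintWinKernelTree`; check 1/4,
`…KernNFZ5B7Check1`, covers `[0, 276420)` with the linear table).  Does NOT build on p205010.
-/

namespace Summit.CriticalPhenomena.PercolationContinuityZ3.Theorems.Pcint.NFZ5B7

set_option maxHeartbeats 0 in
/-- The 48 rows with normal-form code in `[276420, 310320)` hold. [folklore] -/
theorem chk_276420_310320 : (WinK.nfCodesIn 5 6 276420 310320).all (WinK.rowOKBT 5 5 1145 10066 9935 99999 (WinK.KT.ofListF 11 tbl) 72351) = true :=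
  WinK.all_of_allB (fuel := 20) (by decide +kernel)

set_option maxHeartbeats 0 in
/-- The 48 rows with normal-form code in `[310320, 321010)` hold. [folklore] -/
theorem chk_310320_321010 : (WinK.nfCodesIn 5 6 310320 321010).all (WinK.rowOKBT 5 5 1145 10066 9935 99999 (WinK.KT.ofListF 11 tbl) 72351) = true :=
  WinK.all_of_allB (fuel := 20) (by decide +kernel)

set_option maxHeartbeats 0 in
/-- The 48 rows with normal-form code in `[321010, 331220)` hold. [folklore] -/
theorem chk_321010_331220 : (WinK.nfCodesIn 5 6 321010 331220).all (WinK.rowOKBT 5 5 1145 10066 9935 99999 (WinK.KT.ofListF 11 tbl) 72351) = true :=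
  WinK.all_of_allB (fuel := 20) (by decide +kernel)

set_option maxHeartbeats 0 in
/-- The 48 rows with normal-form code in `[331220, 342110)` hold. [folklore] -/
theorem chk_331220_342110 : (WinK.nfCodesIn 5 6 331220 342110).all (WinK.rowOKBT 5 5 1145 10066 9935 99999 (WinK.KT.ofListF 11 tbl) 72351) = true :=
  WinK.all_of_allB (fuel := 20) (by decide +kernel)

set_option maxHeartbeats 0 in
/-- The 48 rows with normal-form code in `[342110, 366420)` hold. [folklore] -/
theorem chk_342110_366420 : (WinK.nfCodesIn 5 6 342110 366420).all (WinK.rowOKBT 5 5 1145 10066 9935 99999 (WinK.KT.ofListF 11 tbl) 72351) = true :=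
  WinK.all_of_allB (fuel := 20) (by decide +kernel)

set_option maxHeartbeats 0 in
/-- The 17 rows with normal-form code in `[366420, 402000)` hold. [folklore] -/
theorem chk_366420_402000 : (WinK.nfCodesIn 5 6 366420 402000).all (WinK.rowOKBT 5 5 1145 10066 9935 99999 (WinK.KT.ofListF 11 tbl) 72351) = true :=
  WinK.all_of_allB (fuel := 20) (by decide +kernel)

/-- The rows with normal-form code in `[276420, 402000)` hold. [folklore] -/
theorem chkFile_2 : (WinK.nfCodesIn 5 6 276420 402000).all (WinK.rowOKBT 5 5 1145 10066 9935 99999 (WinK.KT.ofListF 11 tbl) 72351) = true :=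
  WinK.all_nfCodesIn_append (WinK.all_nfCodesIn_append (WinK.all_nfCodesIn_append (WinK.all_nfCodesIn_append (WinK.all_nfCodesIn_append chk_276420_310320 chk_310320_321010) chk_321010_331220) chk_331220_342110) chk_342110_366420) chk_366420_402000

end Summit.CriticalPhenomena.PercolationContinuityZ3.Theorems.Pcint.NFZ5B7
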